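import Mathlib.RingTheory.Ideal.KrullsHeightTheorem
import Mathlib.RingTheory.Length
import Mathlib.RingTheory.KrullDimension.Zero
import Mathlib.RingTheory.HopkinsLevitzki
import Mathlib.RingTheory.Ideal.Quotient.Basic
import Literature.AlgebraicGeometry.Motives.CyclesEquivalences
import Literature.AlgebraicGeometry.Motives.FiberStalk
import Literature.AlgebraicGeometry.Motives.GeometricallyReducedPerfectField
import HarnessLib

/-!
# Base change of cycle classes over a perfect field: proof (hodge.S10)

Discharges the named fact `Literature.AlgebraicGeometry.Motives.comap_cycleClass_eq_cycleMap_baseChange` of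
`Literature/AlgebraicGeometry/Motives/CyclesEquivalences`: over a perfect field `k`, for a
pre-Weil cohomology theory `W` on `L`-schemes, `σ : k →+* L`, `X` locally of finite type over `k`
and `z ∈ X`, the multiplicity-one cycle class
`(W.comap σ).cycleClass X p z = ∑_{z' ∈ pointsOver σ X z} cl(closure {z'})` (prelude `BaseChange`)
equals `W.cycleMap X_σ p (π^*[closure {z}])`, the class of the honest base change of the prime
cycle along `π : X_σ = X ×_{k,σ} Spec L ⟶ X` (prelude `SubschemeCycles`).

## Proof

Both sides are `finsum`s over the points `z'` of `X_σ` of `(coefficient) • cl(closure {z'})`, and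
we show that the coefficients agree pointwise (so no finiteness of supports is needed): for `z'`
over `z`, the coefficient of `π^*[closure {z}]` at `z'` is the multiplicity
`ℓ(𝒪_{π⁻¹(z), z'})` of the scheme-theoretic fibre `π⁻¹(z) = Spec (κ(z) ⊗_k L)` at `z'`, and we
prove (`Literature.AlgebraicGeometry.Motives.stalkLength_fiber_asFiber_eq`) that it is `1` if `codim z' = codim z` and `0` (the
junk value of `Literature.AlgebraicGeometry.Motives.stalkLength` for local rings of infinite length) otherwise:

* **Dimension formula** (EGA IV₂ Cor. (6.1.2), p. 135: for a local homomorphism `A → B` of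
  Noetherian local rings with `B` flat over `A`, `dim B = dim A + dim (B ⊗_A k)`; Matsumura,
  *Commutative Ring Theory*, Thm. 15.1): `Literature.AlgebraicGeometry.Motives.ringKrullDim_eq_add_of_flat_of_isLocalHom`, from
  Mathlib's height form `Ideal.height_eq_height_add_of_liesOver_of_hasGoingDown` (Stacks 00ON).
  At a point `x` of a flat morphism `f : X' ⟶ X` of locally Noetherian schemes this reads
  `codim x = codim (f x) + dim 𝒪_{X'_{f x}, x}`
(`Literature.AlgebraicGeometry.Motives.coheight_eq_coheight_add_ringKrullDim_stalk_fiber`;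
  Mathlib `ringKrullDim_stalk_eq_coheight`, and `𝒪_{X'_{f x}, x} ≅ 𝒪_{X',x}/𝔪_{f x}𝒪_{X',x}` from
  `Literature/…/FiberStalk`).
* **Reduced fibres** (EGA IV₂ Prop. (4.6.1)/Cor. (4.3.6): over a perfect field every reduced
  scheme is geometrically reduced): `π` is a base change of `Spec L ⟶ Spec k`, which is
  geometrically reduced (`Literature.AlgebraicGeometry.Motives.geometricallyReduced_SpecMap_ringHom_of_perfectField`, file
  `GeometricallyReducedPerfectField`), so all fibres of `π` are reduced (Mathlib instances).
* **Lengths of reduced local rings**: a reduced local ring of dimension `0` is a field, of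
  length `1` (`Literature.AlgebraicGeometry.Motives.length_self_eq_one_of_ringKrullDim_eq_zero`); a ring of finite length is
  Artinian, of dimension `0` (`Literature.AlgebraicGeometry.Motives.ringKrullDim_eq_zero_of_length_ne_top`).

## References

* A. Grothendieck, J. Dieudonné, EGA IV₂ (Publ. Math. IHÉS 24, 1965): Prop. (4.6.1), p. 68;
  Cor. (4.3.6), p. 58; Prop. (6.1.1) and Cor. (6.1.2), p. 135.
* W. Fulton, *Intersection Theory* (2nd ed. 1998), §1.5 (cycle of a scheme, multiplicities
  `ℓ(𝒪_{V,X})`), §1.7, and Example 6.2.9 (cycles and extension of the ground field, `α ↦ α_L`,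
  `[V] ↦ [V_L]`). (The prelude docstrings point to "Ex. 6.1.2"; the example on field extension is
  Example 6.2.9.)
* H. Matsumura, *Commutative Ring Theory* (1987), Thm. 15.1.
* The Stacks Project, Tag 00ON.
-/

universe u v

open CategoryTheory AlgebraicGeometry Limits Order IsLocalRing

namespace Literature.AlgebraicGeometry.Motives

/-! ### Local algebra -/

section LocalAlgebra

/-- **EGA IV₂ Cor. (6.1.2)** (dimension formula for flat local homomorphisms; Matsumura,
*Commutative Ring Theory*, Thm. 15.1): for a local homomorphism `A → B` of Noetherian local rings
with `B` flat over `A`, `dim B = dim A + dim (B / 𝔪_A B)`. Derived from Mathlib's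
`Ideal.height_eq_height_add_of_liesOver_of_hasGoingDown` (Stacks 00ON; flat ⇒ going down) applied
to the maximal ideals. [cite: GrothendieckDieudonne1965, Cor. (6.1.2), p. 135] -/
theorem ringKrullDim_eq_add_of_flat_of_isLocalHom (A B : Type*) [CommRing A] [CommRing B]
    [IsLocalRing A] [IsLocalRing B] [IsNoetherianRing A] [IsNoetherianRing B] [Algebra A B]
    [IsLocalHom (algebraMap A B)] [Module.Flat A B] :
    ringKrullDim B =
      ringKrullDim A + ringKrullDim (B ⧸ (maximalIdeal A).map (algebraMap A B)) := by
  set I : Ideal B := (maximalIdeal A).map (algebraMap A B) with hI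
  have hIle : I ≤ maximalIdeal B := by
    rw [hI, Ideal.map_le_iff_le_comap]
    intro a ha
    rw [Ideal.mem_comap, mem_maximalIdeal, mem_nonunits_iff, isUnit_map_iff]
    exact ha
  have hItop : I ≠ ⊤ := fun h ↦ (maximalIdeal.isMaximal B).ne_top (top_le_iff.mp (h ▸ hIle))
  haveI : Nontrivial (B ⧸ I) := Ideal.Quotient.nontrivial_iff.mpr hItop
  haveI := IsLocalRing.of_surjective' (Ideal.Quotient.mk I) Ideal.Quotient.mk_surjective
  haveI := IsLocalHom.of_surjective (Ideal.Quotient.mk I) Ideal.Quotient.mk_surjective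
  have hmax : (maximalIdeal B).map (Ideal.Quotient.mk I) = maximalIdeal (B ⧸ I) := by
    ext x
    obtain ⟨x, rfl⟩ := Ideal.Quotient.mk_surjective x
    simp [sup_eq_left.mpr (le_maximalIdeal hItop)]
  have h := Ideal.height_eq_height_add_of_liesOver_of_hasGoingDown (maximalIdeal A) (maximalIdeal B)
  rw [← hI, hmax] at h
  rw [← maximalIdeal_height_eq_ringKrullDim, ← maximalIdeal_height_eq_ringKrullDim,
    ← maximalIdeal_height_eq_ringKrullDim, h, WithBot.coe_add]

/-- A reduced local ring of Krull dimension `0` is a field (Mathlib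
`Ring.KrullDimLE.isField_of_isReduced`), hence of length `1` as a module over itself. This is
the multiplicity `1` of a generic point of a reduced scheme (Fulton, *Intersection Theory*, §1.5).
[folklore] -/
theorem length_self_eq_one_of_ringKrullDim_eq_zero (R : Type*) [CommRing R] [IsLocalRing R]
    [IsReduced R] (h : ringKrullDim R = 0) : Module.length R R = 1 := by
  haveI : Ring.KrullDimLE 0 R := ringKrullDimZero_iff_ringKrullDim_eq_zero.mpr h
  have hF := Ring.KrullDimLE.isField_of_isReduced (R := R)
  rw [Module.length_eq_one_iff, isSimpleModule_self_iff_isUnit]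
  refine ⟨inferInstance, fun x hx ↦ ?_⟩
  obtain ⟨y, hy⟩ := hF.mul_inv_cancel hx
  exact isUnit_iff_exists_inv.mpr ⟨y, hy⟩

/-- A (nontrivial commutative) ring of finite length over itself is Artinian, hence of Krull
dimension `0` (Atiyah–Macdonald, Thm. 8.5; Mathlib `isFiniteLength_iff_isNoetherian_isArtinian`
and the instance `IsArtinianRing → Ring.KrullDimLE 0`). [cite: AtiyahMacdonald1969, Theorem 8.5] -/
theorem ringKrullDim_eq_zero_of_length_ne_top (R : Type*) [CommRing R] [Nontrivial R]
    (h : Module.length R R ≠ ⊤) : ringKrullDim R = 0 := by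
  haveI : IsArtinianRing R :=
    (isFiniteLength_iff_isNoetherian_isArtinian.mp (Module.length_ne_top_iff.mp h)).2
  exact ringKrullDimZero_iff_ringKrullDim_eq_zero.mp inferInstance

end LocalAlgebra

/-! ### The dimension formula at a point of a flat morphism -/

section Schemes

variable {X' X : Scheme.{u}} (f : X' ⟶ X)

/-- **Dimension formula at a point of a flat morphism** (EGA IV₂ Cor. (6.1.2), p. 135, applied to
`𝒪_{X, f x} → 𝒪_{X', x}`): for a flat morphism `f : X' ⟶ X` of locally Noetherian schemes and
`x ∈ X'`, `codim x = codim (f x) + dim 𝒪_{X'_{f x}, x}`, where `codim` is `Order.coheight` in the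
specialisation order (`= dim 𝒪_{X,x}`, Mathlib `ringKrullDim_stalk_eq_coheight`) and
`X'_{f x} = f.fiber (f x)` is the scheme-theoretic fibre, whose local ring at `x` is
`𝒪_{X',x} / 𝔪_{f x} 𝒪_{X',x}` (`Literature.AlgebraicGeometry.Motives.nonempty_stalkFiber_ringEquiv_asFiber`). Stated in `WithBot ℕ∞`.
[cite: GrothendieckDieudonne1965, Cor. (6.1.2), p. 135] -/
theorem coheight_eq_coheight_add_ringKrullDim_stalk_fiber [Flat f] [IsLocallyNoetherian X']
    [IsLocallyNoetherian X] (x : X') :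
    (coheight x : WithBot ℕ∞) =
      coheight (f x) + ringKrullDim ((f.fiber (f x)).presheaf.stalk (f.asFiber x)) := by
  let A := ↑(X.presheaf.stalk (f x))
  let B := ↑(X'.presheaf.stalk x)
  letI : Algebra A B := (f.stalkMap x).hom.toAlgebra
  haveI : IsLocalHom (algebraMap A B) := inferInstanceAs (IsLocalHom (f.stalkMap x).hom)
  haveI : Module.Flat A B := Flat.stalkMap f x
  obtain ⟨e⟩ := nonempty_stalkFiber_ringEquiv_asFiber f x
  rw [← ringKrullDim_stalk_eq_coheight, ← ringKrullDim_stalk_eq_coheight,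
    ringKrullDim_eq_of_ringEquiv e]
  exact ringKrullDim_eq_add_of_flat_of_isLocalHom A B

/-- **Multiplicities of a reduced fibre of a flat morphism.** For a flat morphism `f : X' ⟶ X` of
locally Noetherian schemes and a point `x ∈ X'` whose fibre `X'_{f x}` is a reduced scheme, the
multiplicity `ℓ(𝒪_{X'_{f x}, x})` (`Literature.AlgebraicGeometry.Motives.stalkLength`, with junk value `0` for infinite length) is
`1` if `codim x = codim (f x)` — i.e. if `x` is a generic point of an irreducible component of
the fibre, by the dimension formula EGA IV₂ Cor. (6.1.2) — and `0` otherwise: the local ring of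
the reduced fibre at such a generic point is a reduced Artinian local ring, i.e. a field, of
length `1`, while at the other points it has positive dimension, hence infinite length
(Fulton, *Intersection Theory*, §1.5: the coefficient of a component in the cycle `[Z]` of a scheme
is the length of the Artinian local ring at its generic point; Example 6.2.9 for `[V] ↦ [V_L]`).
[folklore] -/
theorem stalkLength_fiber_asFiber_eq [Flat f] [IsLocallyNoetherian X'] [IsLocallyNoetherian X]
    (x : X') [IsReduced (f.fiber (f x))] :
    stalkLength (f.fiber (f x)) (f.asFiber x) = if coheight x = coheight (f x) then 1 else 0 := by
  set R := ↑((f.fiber (f x)).presheaf.stalk (f.asFiber x)) with hR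
  have hdim := coheight_eq_coheight_add_ringKrullDim_stalk_fiber f x
  -- all dimensions are finite
  have hA : (coheight (f x) : WithBot ℕ∞) = (maximalIdeal ↑(X.presheaf.stalk (f x))).height := by
    rw [maximalIdeal_height_eq_ringKrullDim, ringKrullDim_stalk_eq_coheight]
  have hAfin : coheight (f x) ≠ ⊤ := by
    rw [WithBot.coe_inj.mp hA]
    exact Ideal.height_ne_top (maximalIdeal.isMaximal _).ne_top
  have hRdim : ringKrullDim R = (maximalIdeal R).height :=
    (maximalIdeal_height_eq_ringKrullDim).symm
  rw [hRdim, ← WithBot.coe_add, WithBot.coe_inj] at hdim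
  -- `codim x = codim (f x)` iff `dim R = 0`
  have key : coheight x = coheight (f x) ↔ ringKrullDim R = 0 := by
    rw [hdim, hRdim]
    constructor
    · intro h
      have h' : (maximalIdeal R).height + coheight (f x) = 0 + coheight (f x) := by
        rw [zero_add, add_comm]
        exact h
      rw [ENat.add_left_injective_of_ne_top hAfin h', WithBot.coe_zero]
    · intro h
      have h' : (maximalIdeal R).height = 0 := by exact_mod_cast h
      rw [h', add_zero]
  simp only [stalkLength]
  split_ifs with hc
  · rw [length_self_eq_one_of_ringKrullDim_eq_zero R (key.mp hc)]
    rfl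
  · rw [ENat.toNat_eq_zero]
    refine Or.inr ?_
    by_contra hne
    exact hc (key.mpr (ringKrullDim_eq_zero_of_length_ne_top R hne))

end Schemes

/-! ### Discharge of `comap_cycleClass_eq_cycleMap_baseChange` -/

section Hodge

/-- **Discharge of the named fact `Literature.AlgebraicGeometry.Motives.comap_cycleClass_eq_cycleMap_baseChange`**
(hodge.S10, base change of cycle classes; EGA IV₂ Prop. (4.6.1), p. 68, with Fulton,
*Intersection Theory*, Example 6.2.9, `[V] ↦ [V_L]`). Over a perfect field `k`, the cycle class
of `closure {z}` in `W.comap σ` — the sum of the classes of the points `z'` of `X_σ` over `z` of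
the same codimension — equals the class in `W` of the base-changed cycle `π^*[closure {z}]`:
the coefficient of `π^*[closure {z}]` at `z'` over `z` is the length of the local ring at `z'` of
the fibre `π⁻¹(z) = Spec (κ(z) ⊗_k L)`, which is reduced for `k` perfect (EGA IV₂ (4.6.1),
`Literature.AlgebraicGeometry.Motives.geometricallyReduced_SpecMap_ringHom_of_perfectField`), so this length is `1` exactly at
the generic points of the components of the fibre, which by the dimension formula
(EGA IV₂ (6.1.2)) are exactly the points over `z` of the same codimension
(`Literature.AlgebraicGeometry.Motives.stalkLength_fiber_asFiber_eq`); elsewhere it is the junk value `0`. The two `finsum`s thus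
have the same summands. [cite: GrothendieckDieudonne1965, Prop. (4.6.1), p. 68] -/
theorem comap_cycleClass_eq_cycleMap_baseChange_holds :
    comap_cycleClass_eq_cycleMap_baseChange.{u, v} := by
  classical
  intro k L _ _ K _ _ W σ X _ hπ p z
  rw [PreWeilCohomology.comap_cycleClass, finsum_mem_def, PreWeilCohomology.cycleMap]
  refine finsum_congr fun z' ↦ ?_
  change (pointsOver σ X z).indicator (W.cycleClass ((baseChangeHom σ).obj X) p) z' =
    (AlgebraicCycle.baseChange σ X hπ (primeCycle z)) z' •
      W.cycleClass ((baseChangeHom σ).obj X) p z'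
  set π := baseChangeHomFst σ X with hπdef
  haveI : IsLocallyNoetherian X.left := LocallyOfFiniteType.isLocallyNoetherian X.hom
  haveI : IsLocallyNoetherian ((baseChangeHom σ).obj X).left :=
    inferInstanceAs (IsLocallyNoetherian
      ↑(pullback X.hom (Spec.map (CommRingCat.ofHom σ))))
  haveI : GeometricallyReduced π := by
    haveI := geometricallyReduced_SpecMap_ringHom_of_perfectField σ
    exact inferInstanceAs
      (GeometricallyReduced (pullback.fst X.hom (Spec.map (CommRingCat.ofHom σ))))
  rw [Set.indicator_apply, mem_pointsOver_iff, AlgebraicCycle.baseChange_apply]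
  simp only [Scheme.Hom.flatPullbackFun, fundamentalCycleFun_apply]
  by_cases hz : π.base z' = z
  · subst hz
    rw [← hπdef, primeCycle_apply_self, one_mul, stalkLength_fiber_asFiber_eq π z']
    by_cases hc : coheight z' = coheight (π.base z')
    · rw [if_pos ⟨rfl, hc⟩, if_pos hc, Nat.cast_one, one_smul]
    · rw [if_neg fun h ↦ hc h.2, if_neg hc, Nat.cast_zero, zero_smul]
  · rw [← hπdef, primeCycle_apply_of_ne hz, zero_mul, zero_smul, if_neg fun h ↦ hz h.1]

end Hodge

end Literature.AlgebraicGeometry.Motives
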